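/-
Copyright: internal research formalization. Source text: A. DasGupta, *Asymptotic Theory of
Statistics and Probability* (Springer 2008) [DasGupta2008], p. 718 (held
`book:dasgupta2008-asymptotic-theory-statistics-probability`, chunk p0718): "**Mitrinovic
Inequality** For `x > 0`, `2/(x + √(x²+4)) < R(x) < 2/(x + √(x²+8/π))`" and "**Szarek-Werner
Inequality** For `x > -1`, `2/(x + √(x²+4)) < R(x) < 4/(3x + √(x²+8))`"; the upper halves go back
to M. R. Sampford, Ann. Math. Statist. 24 (1953) 130–132 (convexity of the hazard) and to
H. O. Pollak's remark to Gordon's note, both cited through DasGupta and not re-read here.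
-/
import Literature.Probability.HeavyTails.LogNormalTailHillTarget
import HarnessLib

/-!
# The UPPER bounds on the normal Mills ratio: Szarek–Werner / Sampford and Mitrinović / Pollak;
# convexity of the normal hazard rate

Literature formalization (theorems only, no named facts), companion of
`Literature/Probability/HeavyTails/LogNormalTailHillTarget.lean`, whose `GaussianTail` section types
the Mills ratio `R = Φ̄/φ` of the standard normal law with Gordon's bounds, the continued-fraction
levels 2–5 and the Birnbaum / Mitrinović / Szarek–Werner LOWER bound `2/(x + √(x²+4)) < R(x)`
(`GaussianTail.birnbaum_lt_millsRatio`), and lists as NOT typed "the Mitrinović upper constant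
`8/π` and Sampford's `4/(3x + √(x²+8))`".  This file proves BOTH, AS PRINTED by DasGupta (p. 718):

* *"**Szarek-Werner Inequality** For `x > -1`, `… R(x) < 4/(3x + √(x²+8))`"* —
  `GaussianTail.millsRatio_lt_sampford`, with its mean-residual-life form
  `(√(z²+8) − z)/4 < m(z)` for every real `z` (`GaussianTail.sampford_lt_meanResidualLife`) and the
  polynomial form `2N² + xNΦ̄ − Φ̄² > 0`, `N = φ − xΦ̄` (`GaussianTail.sampford_pos`; with `m = N/Φ̄`
  this reads `2m² + xm − 1 > 0`);
* the CONVEXITY of the normal hazard rate `h = φ/Φ̄` (Sampford 1953): `h′ = φN/Φ̄²`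
  (`GaussianTail.hasDerivAt_hazardRate`), `h″ = φ(2N² + xNΦ̄ − Φ̄²)/Φ̄³ > 0`
  (`GaussianTail.hasDerivAt_hazardRate_deriv`, `GaussianTail.strictMono_hazardRate_deriv`),
  `GaussianTail.strictConvexOn_hazardRate`;
* *"**Mitrinovic Inequality** For `x > 0`, `… R(x) < 2/(x + √(x² + 8/π))`"* —
  `GaussianTail.millsRatio_lt_mitrinovic`: since `h′` is increasing, `h′(x) > h′(0) = 2/π` for
  `x > 0` (`GaussianTail.hazardRate_deriv_zero`, `GaussianTail.two_div_pi_lt_hazardRate_deriv`),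
  and `h′ = h(h − x) > 2/π` is the printed bound after solving the quadratic (exact at `x = 0`).

Method for the key positivity (the companion file's ladder device, one storey up): the functional
`C = (2N² + xNΦ̄ − Φ̄²)·Φ̄/φ²` has derivative `C′ = −2N³/φ² < 0` (`GaussianTail.hasDerivAt_sampford`,
from `φ′ = −xφ`, `Φ̄′ = −φ` alone) and tends to `0` at `+∞` (`GaussianTail.tendsto_sampford`,
`|C| ≤ 3Φ̄` for `x ≥ 1` by Gordon's `xΦ̄ ≤ φ`), hence is positive everywhere.  The closed forms then
follow from `8[(x²−1)R² − 3xR + 2] = ((3x+s)R − 4)((3x−s)R − 4)`, `s = √(x²+8)`, resp.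
`(2/π)R² + xR − 1 < 0`.

NOT typed here: Sampford's companion statement `0 < h′ < 1` as such (`h′ < 1` is the companion
file's `birnbaum_pos`), sharper rational / continued-fraction upper bounds beyond level 4, and
anything statistical.  (Filed by the pub-qed literature seat as a typed reading aid — the upper
halves of the Mills-ratio bracket used by the lane's C23 / log-normal-tail readings; VALUE-FREE,
decides no word, prices no cell.)
-/

noncomputable section

open MeasureTheory ProbabilityTheory Filter Set
open scoped Topology NNReal

namespace Literature.Probability.HeavyTails

namespace GaussianTail

/-- An everywhere-differentiable real function with negative derivative and limit `0` at `+∞` is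
positive (the device of `LogNormalTailHillTarget.lean`, whose copy is private there). [folklore] -/
private theorem pos_of_hasDerivAt_neg_of_tendsto_zero {f : ℝ → ℝ} {f' : ℝ → ℝ}
    (hderiv : ∀ x, HasDerivAt f (f' x) x) (hneg : ∀ x, f' x < 0)
    (hlim : Tendsto f atTop (𝓝 0)) (x : ℝ) : 0 < f x := by
  have hanti : StrictAnti f :=
    strictAnti_of_deriv_neg fun y => by rw [(hderiv y).deriv]; exact hneg y
  have h1 : f (x + 1) < f x := hanti (by linarith)
  have h2 : 0 ≤ f (x + 1) :=
    le_of_tendsto hlim ((eventually_ge_atTop (x + 1)).mono fun y hy => hanti.antitone hy)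
  linarith

/-- The Sampford functional `C(x) = (2N² + xNΦ̄ − Φ̄²)·Φ̄/φ²`, `N = φ − xΦ̄`, has derivative
`−2N³/φ²` (only `φ' = −xφ`, `Φ̄' = −φ` are used). [cite: DasGupta2008, p. 718 "Szarek-Werner
Inequality" (upper half)] -/
theorem hasDerivAt_sampford (x : ℝ) :
    HasDerivAt (fun y : ℝ =>
        (2 * ((gaussianPDFReal 0 1 y) - y * ((gaussianReal 0 1).real (Ioi y))) ^ 2 +
            y * ((gaussianPDFReal 0 1 y) - y * ((gaussianReal 0 1).real (Ioi y))) *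
              ((gaussianReal 0 1).real (Ioi y)) -
          ((gaussianReal 0 1).real (Ioi y)) ^ 2) * ((gaussianReal 0 1).real (Ioi y)) /
          (gaussianPDFReal 0 1 y) ^ 2)
      (-(2 * ((gaussianPDFReal 0 1 x) - x * ((gaussianReal 0 1).real (Ioi x))) ^ 3 /
        (gaussianPDFReal 0 1 x) ^ 2)) x := by
  have hφ := pdf_pos x
  have hN := hasDerivAt_pdf_sub_mul_tail x
  have hT := hasDerivAt_tail x
  have hP := hasDerivAt_pdf x
  have h := ((((hN.fun_pow 2).const_mul 2).fun_add (((hasDerivAt_id x).fun_mul hN).fun_mul hT)).fun_sub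
    (hT.fun_pow 2)).fun_mul hT |>.fun_div (hP.fun_pow 2) (pow_ne_zero 2 hφ.ne')
  refine h.congr_deriv ?_
  simp only [id, Nat.cast_ofNat]
  field_simp
  ring

/-- `C(x) → 0` as `x → +∞` (for `x ≥ 1`, `|C| ≤ 3Φ̄`). [cite: DasGupta2008, p. 718 "Szarek-Werner
Inequality" (upper half)] -/
theorem tendsto_sampford :
    Tendsto (fun y : ℝ =>
        (2 * ((gaussianPDFReal 0 1 y) - y * ((gaussianReal 0 1).real (Ioi y))) ^ 2 +
            y * ((gaussianPDFReal 0 1 y) - y * ((gaussianReal 0 1).real (Ioi y))) *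
              ((gaussianReal 0 1).real (Ioi y)) -
          ((gaussianReal 0 1).real (Ioi y)) ^ 2) * ((gaussianReal 0 1).real (Ioi y)) /
          (gaussianPDFReal 0 1 y) ^ 2) atTop (𝓝 0) := by
  refine squeeze_zero_norm' ?_ (by simpa using tendsto_tail.const_mul 3)
  filter_upwards [eventually_ge_atTop (1 : ℝ)] with y hy
  have hφ := pdf_pos y
  have hΦ := tail_pos y
  have hN0 := pdf_sub_mul_tail_nonneg y
  have hxΦ : y * ((gaussianReal 0 1).real (Ioi y)) ≤ gaussianPDFReal 0 1 y := mul_tail_le_pdf y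
  have hΦφ : ((gaussianReal 0 1).real (Ioi y)) ≤ gaussianPDFReal 0 1 y := by
    have : ((gaussianReal 0 1).real (Ioi y)) ≤ y * ((gaussianReal 0 1).real (Ioi y)) := by
      nlinarith
    exact this.trans hxΦ
  have hNφ : (gaussianPDFReal 0 1 y) - y * ((gaussianReal 0 1).real (Ioi y)) ≤ gaussianPDFReal 0 1 y := by
    nlinarith
  set N := (gaussianPDFReal 0 1 y) - y * ((gaussianReal 0 1).real (Ioi y)) with hNdef
  set Φ := ((gaussianReal 0 1).real (Ioi y)) with hΦdef
  set φ := gaussianPDFReal 0 1 y with hφdef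
  have hyNΦ : 0 ≤ y * N * Φ ∧ y * N * Φ ≤ φ ^ 2 := by
    constructor
    · have : 0 ≤ y := by linarith
      positivity
    · have h1 : y * N * Φ = N * (y * Φ) := by ring
      rw [h1]
      nlinarith
  have hS : |2 * N ^ 2 + y * N * Φ - Φ ^ 2| ≤ 3 * φ ^ 2 := by
    rw [abs_le]
    constructor <;> nlinarith
  rw [Real.norm_eq_abs, abs_div, abs_mul, abs_of_pos hΦ, abs_of_pos (pow_pos hφ 2),
    div_le_iff₀ (pow_pos hφ 2)]
  calc |2 * N ^ 2 + y * N * Φ - Φ ^ 2| * Φ ≤ 3 * φ ^ 2 * Φ :=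
        mul_le_mul_of_nonneg_right hS hΦ.le
    _ = 3 * Φ * φ ^ 2 := by ring

/-- **Sampford's inequality in polynomial form**: `C(x) > 0`, hence
`2N² + xNΦ̄ − Φ̄² > 0` for every real `x` — with `m = N/Φ̄` the mean residual life this is
`2m² + xm − 1 > 0`, the convexity of the normal hazard rate. [cite: DasGupta2008, p. 718
"Szarek-Werner Inequality" (upper half)] -/
theorem sampford_pos (x : ℝ) :
    0 < 2 * ((gaussianPDFReal 0 1 x) - x * ((gaussianReal 0 1).real (Ioi x))) ^ 2 +
        x * ((gaussianPDFReal 0 1 x) - x * ((gaussianReal 0 1).real (Ioi x))) *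
          ((gaussianReal 0 1).real (Ioi x)) -
      ((gaussianReal 0 1).real (Ioi x)) ^ 2 := by
  have hφ := pdf_pos x
  have hΦ := tail_pos x
  have hC := pos_of_hasDerivAt_neg_of_tendsto_zero hasDerivAt_sampford
    (fun y => neg_lt_zero.mpr (div_pos (mul_pos two_pos (pow_pos (pdf_sub_mul_tail_pos y) 3))
      (pow_pos (pdf_pos y) 2))) tendsto_sampford x
  have h1 := mul_pos hC (div_pos (pow_pos hφ 2) hΦ)
  rw [div_mul_div_comm, mul_assoc] at h1
  have h2 : ((gaussianReal 0 1).real (Ioi x)) * (gaussianPDFReal 0 1 x) ^ 2 /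
      ((gaussianPDFReal 0 1 x) ^ 2 * ((gaussianReal 0 1).real (Ioi x))) = 1 := by
    rw [mul_comm, div_self (mul_pos (pow_pos hφ 2) hΦ).ne']
  rwa [mul_div_assoc, h2, mul_one] at h1

/-- **Sampford's bound in mean-residual-life form**, for every real `z`:
`(√(z² + 8) − z)/4 < m(z) = φ(z)/Φ̄(z) − z` (the positive root of `2t² + zt − 1`).
[cite: DasGupta2008, p. 718 "Szarek-Werner Inequality" (upper half)] -/
theorem sampford_lt_meanResidualLife (z : ℝ) :
    (Real.sqrt (z ^ 2 + 8) - z) / 4 <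
      (gaussianPDFReal 0 1 z) / ((gaussianReal 0 1).real (Ioi z)) - z := by
  have hΦ := tail_pos z
  have hφ := pdf_pos z
  have hS := sampford_pos z
  set m := (gaussianPDFReal 0 1 z) / ((gaussianReal 0 1).real (Ioi z)) - z with hm
  have hm0 : 0 < m := meanResidualLife_pos z
  have hN : (gaussianPDFReal 0 1 z) - z * ((gaussianReal 0 1).real (Ioi z)) =
      m * ((gaussianReal 0 1).real (Ioi z)) := by
    rw [hm]; field_simp
  -- `2m² + zm − 1 > 0`
  have hq : 0 < 2 * m ^ 2 + z * m - 1 := by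
    rw [hN] at hS
    have h1 : 2 * (m * ((gaussianReal 0 1).real (Ioi z))) ^ 2 +
        z * (m * ((gaussianReal 0 1).real (Ioi z))) * ((gaussianReal 0 1).real (Ioi z)) -
        ((gaussianReal 0 1).real (Ioi z)) ^ 2 =
        ((gaussianReal 0 1).real (Ioi z)) ^ 2 * (2 * m ^ 2 + z * m - 1) := by ring
    rw [h1] at hS
    exact pos_of_mul_pos_right hS (sq_nonneg _)  -- hmm
  have hs0 : 0 ≤ Real.sqrt (z ^ 2 + 8) := Real.sqrt_nonneg _
  have hs2 : Real.sqrt (z ^ 2 + 8) ^ 2 = z ^ 2 + 8 := Real.sq_sqrt (by positivity)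
  -- `4m + z > √(z²+8)`: from `(4m + z)² = 16m² + 8zm + z² > z² + 8` and `4m + z > 0`
  have h4 : 0 < 4 * m + z := by
    by_contra hle
    rw [not_lt] at hle
    nlinarith
  nlinarith

/-- **The Szarek–Werner upper bound (Sampford's inequality) on the Mills ratio**, AS PRINTED:
*"For `x > −1`, `2/(x + √(x²+4)) < R(x) < 4/(3x + √(x²+8))`"* — the upper half; the lower half
is `birnbaum_lt_millsRatio`. [cite: DasGupta2008, p. 718 "Szarek-Werner Inequality" (upper half)] -/
theorem millsRatio_lt_sampford {x : ℝ} (hx : -1 < x) :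
    ((gaussianReal 0 1).real (Ioi x)) / (gaussianPDFReal 0 1 x) <
      4 / (3 * x + Real.sqrt (x ^ 2 + 8)) := by
  have hΦ := tail_pos x
  have hφ := pdf_pos x
  have hm := sampford_lt_meanResidualLife x
  have hs0 : 0 ≤ Real.sqrt (x ^ 2 + 8) := Real.sqrt_nonneg _
  have hs2 : Real.sqrt (x ^ 2 + 8) ^ 2 = x ^ 2 + 8 := Real.sq_sqrt (by positivity)
  -- `3x + √(x²+8) > 0` for `x > −1`
  have hden : 0 < 3 * x + Real.sqrt (x ^ 2 + 8) := by
    by_cases h0 : 0 ≤ x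
    · have : 0 < Real.sqrt (x ^ 2 + 8) := Real.sqrt_pos.2 (by positivity)
      linarith
    · rw [not_le] at h0
      have : (3 * x) ^ 2 < Real.sqrt (x ^ 2 + 8) ^ 2 := by rw [hs2]; nlinarith
      nlinarith
  -- `h = φ/Φ̄ > x + (√(x²+8) − x)/4 = (3x + √(x²+8))/4`
  have hh : (3 * x + Real.sqrt (x ^ 2 + 8)) / 4 <
      (gaussianPDFReal 0 1 x) / ((gaussianReal 0 1).real (Ioi x)) := by linarith
  rw [div_lt_div_iff₀ hφ hden]
  rw [div_lt_div_iff₀ (by norm_num : (0:ℝ) < 4) hΦ] at hh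
  linarith [mul_comm ((gaussianReal 0 1).real (Ioi x)) 4]

/-! ### Convexity of the hazard rate and the Mitrinović / Pollak upper bound `R(x) < 2/(x + √(x²+8/π))` -/

/-- `h′ = φN/Φ̄²` for the normal hazard rate `h = φ/Φ̄` (`h′ = h(h − x)`).
[cite: DasGupta2008, p. 718 "Szarek-Werner Inequality" (upper half)] -/
theorem hasDerivAt_hazardRate (x : ℝ) :
    HasDerivAt (fun y : ℝ => (gaussianPDFReal 0 1 y) / ((gaussianReal 0 1).real (Ioi y)))
      ((gaussianPDFReal 0 1 x) * ((gaussianPDFReal 0 1 x) - x * ((gaussianReal 0 1).real (Ioi x))) /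
        ((gaussianReal 0 1).real (Ioi x)) ^ 2) x := by
  have hΦ := tail_pos x
  have h := (hasDerivAt_pdf x).fun_div (hasDerivAt_tail x) hΦ.ne'
  refine h.congr_deriv ?_
  ring

/-- `h″ = φ·(2N² + xNΦ̄ − Φ̄²)/Φ̄³`: the derivative of `h′ = φN/Φ̄²`.
[cite: DasGupta2008, p. 718 "Szarek-Werner Inequality" (upper half)] -/
theorem hasDerivAt_hazardRate_deriv (x : ℝ) :
    HasDerivAt (fun y : ℝ => (gaussianPDFReal 0 1 y) *
        ((gaussianPDFReal 0 1 y) - y * ((gaussianReal 0 1).real (Ioi y))) /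
          ((gaussianReal 0 1).real (Ioi y)) ^ 2)
      ((gaussianPDFReal 0 1 x) *
        (2 * ((gaussianPDFReal 0 1 x) - x * ((gaussianReal 0 1).real (Ioi x))) ^ 2 +
            x * ((gaussianPDFReal 0 1 x) - x * ((gaussianReal 0 1).real (Ioi x))) *
              ((gaussianReal 0 1).real (Ioi x)) -
          ((gaussianReal 0 1).real (Ioi x)) ^ 2) / ((gaussianReal 0 1).real (Ioi x)) ^ 3) x := by
  have hΦ := tail_pos x
  have h := ((hasDerivAt_pdf x).fun_mul (hasDerivAt_pdf_sub_mul_tail x)).fun_div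
    ((hasDerivAt_tail x).fun_pow 2) (pow_ne_zero 2 hΦ.ne')
  refine h.congr_deriv ?_
  simp only [Nat.cast_ofNat]
  field_simp
  ring

/-- **The normal hazard rate has a strictly increasing derivative** (`h″ > 0`, Sampford 1953: the
normal hazard rate is strictly convex), from `sampford_pos`.
[cite: DasGupta2008, p. 718 "Szarek-Werner Inequality" (upper half)] -/
theorem strictMono_hazardRate_deriv :
    StrictMono fun y : ℝ => (gaussianPDFReal 0 1 y) *
      ((gaussianPDFReal 0 1 y) - y * ((gaussianReal 0 1).real (Ioi y))) /
        ((gaussianReal 0 1).real (Ioi y)) ^ 2 := by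
  refine strictMono_of_deriv_pos fun x => ?_
  rw [(hasDerivAt_hazardRate_deriv x).deriv]
  exact div_pos (mul_pos (pdf_pos x) (sampford_pos x)) (pow_pos (tail_pos x) 3)

/-- **The normal hazard rate is strictly convex on `ℝ`** (Sampford 1953; equivalent to the
Szarek–Werner upper bound). [cite: DasGupta2008, p. 718 "Szarek-Werner Inequality" (upper half)] -/
theorem strictConvexOn_hazardRate :
    StrictConvexOn ℝ univ fun y : ℝ => (gaussianPDFReal 0 1 y) / ((gaussianReal 0 1).real (Ioi y)) := by
  have hderiv : deriv (fun y : ℝ => (gaussianPDFReal 0 1 y) / ((gaussianReal 0 1).real (Ioi y))) =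
      fun y => (gaussianPDFReal 0 1 y) * ((gaussianPDFReal 0 1 y) - y * ((gaussianReal 0 1).real (Ioi y))) /
        ((gaussianReal 0 1).real (Ioi y)) ^ 2 :=
    funext fun y => (hasDerivAt_hazardRate y).deriv
  refine StrictMonoOn.strictConvexOn_of_deriv convex_univ
    (fun y _ => (hasDerivAt_hazardRate y).continuousAt.continuousWithinAt) ?_
  rw [interior_univ, hderiv]
  exact strictMono_hazardRate_deriv.strictMonoOn _

/-- `h′(0) = 2/π` (`φ(0) = 1/√(2π)`, `Φ̄(0) = 1/2`). [cite: DasGupta2008, p. 718 "Mitrinovic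
Inequality" (upper half)] -/
theorem hazardRate_deriv_zero :
    (gaussianPDFReal 0 1 0) * ((gaussianPDFReal 0 1 0) - 0 * ((gaussianReal 0 1).real (Ioi 0))) /
      ((gaussianReal 0 1).real (Ioi 0)) ^ 2 = 2 / Real.pi := by
  rw [tail_zero, pdf_eq]
  have hπ : 0 < Real.pi := Real.pi_pos
  have hs : Real.sqrt (2 * Real.pi) ^ 2 = 2 * Real.pi := Real.sq_sqrt (by positivity)
  have hs0 : Real.sqrt (2 * Real.pi) ≠ 0 := (Real.sqrt_pos.2 (by positivity)).ne'
  simp only [neg_zero, zero_pow two_ne_zero, zero_div, Real.exp_zero, mul_one, zero_mul, sub_zero]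
  field_simp
  rw [hs]

/-- **`h′(x) > 2/π` for `x > 0`**, i.e. `φ(x)(φ(x) − xΦ̄(x)) > (2/π) Φ̄(x)²` — the monotone
derivative of the convex hazard exceeds its value at `0`. [cite: DasGupta2008, p. 718 "Mitrinovic
Inequality" (upper half)] -/
theorem two_div_pi_lt_hazardRate_deriv {x : ℝ} (hx : 0 < x) :
    2 / Real.pi < (gaussianPDFReal 0 1 x) * ((gaussianPDFReal 0 1 x) - x * ((gaussianReal 0 1).real (Ioi x))) /
      ((gaussianReal 0 1).real (Ioi x)) ^ 2 := by
  rw [← hazardRate_deriv_zero]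
  exact strictMono_hazardRate_deriv hx

/-- **The Mitrinović (Pollak) upper bound on the Mills ratio**, AS PRINTED: *"**Mitrinovic
Inequality** For `x > 0`, `2/(x + √(x²+4)) < R(x) < 2/(x + √(x² + 8/π))`"* — the upper half (exact
at `x = 0`, where `R(0) = √(π/2)`); the lower half is `birnbaum_lt_millsRatio`.
[cite: DasGupta2008, p. 718 "Mitrinovic Inequality" (upper half)] -/
theorem millsRatio_lt_mitrinovic {x : ℝ} (hx : 0 < x) :
    ((gaussianReal 0 1).real (Ioi x)) / (gaussianPDFReal 0 1 x) <
      2 / (x + Real.sqrt (x ^ 2 + 8 / Real.pi)) := by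
  have hΦ := tail_pos x
  have hφ := pdf_pos x
  have hπ : 0 < Real.pi := Real.pi_pos
  have hd := two_div_pi_lt_hazardRate_deriv hx
  set R := ((gaussianReal 0 1).real (Ioi x)) / (gaussianPDFReal 0 1 x) with hR
  have hRpos : 0 < R := div_pos hΦ hφ
  have hRΦ : ((gaussianReal 0 1).real (Ioi x)) = R * (gaussianPDFReal 0 1 x) := by
    rw [hR, div_mul_cancel₀ _ hφ.ne']
  -- in terms of `R`: `(2/π) R² + x R − 1 < 0`
  have hq : 2 / Real.pi * R ^ 2 + x * R - 1 < 0 := by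
    rw [hRΦ, lt_div_iff₀ (by positivity)] at hd
    have h1 : (gaussianPDFReal 0 1 x) * ((gaussianPDFReal 0 1 x) - x * (R * gaussianPDFReal 0 1 x)) -
        2 / Real.pi * (R * gaussianPDFReal 0 1 x) ^ 2 =
        (gaussianPDFReal 0 1 x) ^ 2 * (-(2 / Real.pi * R ^ 2 + x * R - 1)) := by ring
    have h2 : 0 < (gaussianPDFReal 0 1 x) ^ 2 * (-(2 / Real.pi * R ^ 2 + x * R - 1)) := by
      rw [← h1]; linarith
    have h3 := pos_of_mul_pos_right h2 (sq_nonneg _)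
    linarith
  have hs0 : 0 < Real.sqrt (x ^ 2 + 8 / Real.pi) := Real.sqrt_pos.2 (by positivity)
  have hs2 : Real.sqrt (x ^ 2 + 8 / Real.pi) ^ 2 = x ^ 2 + 8 / Real.pi := Real.sq_sqrt (by positivity)
  have hden : 0 < x + Real.sqrt (x ^ 2 + 8 / Real.pi) := by linarith
  -- `(4/π) R + x < √(x² + 8/π)` since its square is `x² + 8/π + (16/π)((2/π)R² + xR − 1)/…`:
  -- `((4/π)R + x)² = x² + (8/π) x R + (16/π²) R² = x² + (8/π)(xR + (2/π)R²) < x² + 8/π`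
  have hlt : 4 / Real.pi * R + x < Real.sqrt (x ^ 2 + 8 / Real.pi) := by
    have hpos : 0 < 4 / Real.pi * R + x := by positivity
    have hsq : (4 / Real.pi * R + x) ^ 2 < x ^ 2 + 8 / Real.pi := by
      have : (4 / Real.pi * R + x) ^ 2 = x ^ 2 + 8 / Real.pi * (x * R + 2 / Real.pi * R ^ 2) := by
        field_simp; ring
      rw [this]
      have h8 : 0 < 8 / Real.pi := by positivity
      nlinarith
    nlinarith [Real.sqrt_nonneg (x ^ 2 + 8 / Real.pi)]
  have hlt' : R < Real.pi / 4 * (Real.sqrt (x ^ 2 + 8 / Real.pi) - x) := by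
    have h4 : 4 / Real.pi * R < Real.sqrt (x ^ 2 + 8 / Real.pi) - x := by linarith
    calc R = Real.pi / 4 * (4 / Real.pi * R) := by field_simp
      _ < Real.pi / 4 * (Real.sqrt (x ^ 2 + 8 / Real.pi) - x) :=
          mul_lt_mul_of_pos_left h4 (by positivity)
  have hkey : R * (x + Real.sqrt (x ^ 2 + 8 / Real.pi)) <
      Real.pi / 4 * (Real.sqrt (x ^ 2 + 8 / Real.pi) - x) * (x + Real.sqrt (x ^ 2 + 8 / Real.pi)) :=
    mul_lt_mul_of_pos_right hlt' hden
  have hval : Real.pi / 4 * (Real.sqrt (x ^ 2 + 8 / Real.pi) - x) *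
      (x + Real.sqrt (x ^ 2 + 8 / Real.pi)) = 2 := by
    have : (Real.sqrt (x ^ 2 + 8 / Real.pi) - x) * (x + Real.sqrt (x ^ 2 + 8 / Real.pi)) =
        Real.sqrt (x ^ 2 + 8 / Real.pi) ^ 2 - x ^ 2 := by ring
    rw [mul_assoc, this, hs2]
    field_simp
    ring
  rw [lt_div_iff₀ hden]
  linarith

end GaussianTail

end Literature.Probability.HeavyTails
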